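import Summits.BirchSwinnertonDyer.BirchSwinnertonDyer.Theorems.SignedLowerHalvesKobayashiMainConjectureSmallImageMuTransferCM
import Summits.BirchSwinnertonDyer.BirchSwinnertonDyer.Theorems.SignedLowerHalvesKobayashiMainConjectureSmallImageCMTransferMuRecords01
import Summits.BirchSwinnertonDyer.Rank1Residual.Supersingular.NonsplitCartanThreeDescentRecordsX7Three02
import Summits.BirchSwinnertonDyer.Rank1Residual.Supersingular.NonsplitCartanThreeDescentRecordsX7Three03
import Summits.BirchSwinnertonDyer.Rank1Residual.Supersingular.NonsplitCartanThreeDescentRecordsX7Three04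
import Summits.BirchSwinnertonDyer.Rank1Residual.Supersingular.NonsplitCartanThreeDescentRecordsX7Three05
import HarnessLib

/-!
# Route `SignedLowerHalves`, crux `KobayashiMainConjectureSmallImage` (item stmt-BirchSwinnertonDyer-19002) —
# L4-PUB per-pair records MuRecords01: Kobayashi's ± main conjecture for 5 rank-0 CM-EC-partnered non-surjective pairs
# from PUBLISHED named facts + displayed certificates, NO preprint binder (cell `bsd-ssimc`, seat `bsd-ssimc-k3-c4` gen 4)

HONEST FRAMING: Kobayashi's signed main conjecture at a non-surjective (normaliser-of-non-split-Cartan)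
image is OPEN as a class statement; item 4 stays OPEN; nothing here is booked; BSD is not proved by any
of this. These are PER-PAIR theorems. Each one re-derives, for the SAME pair, SAME CM partner and SAME
kernel-certified congruence as the landed L4-CM record (file `SignedLowerHalvesKobayashiMainConjectureSmallImageCMTransferMuRecords01.lean`), the conclusion
`KobayashiMainConjecture W p ε` for BOTH signs — but its closure contains NO preprint: the OPEN binder
`CorpuzLei2025_signedMainConjecture_transfer_OPEN` of the landed record is replaced by PUBLISHED named
facts consumed BY NAME (B. D. Kim 2009 Cor. 2.13 = `BDKim2009.cor213_signedMu_eq_zero_iff_of_torsionIso`;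
Kobayashi 2003 Thm. 1.2 and Thm. 4.1 RATIONAL clause; B. D. Kim 2013 Cor. 3.15; Pollack 2003; modularity;
GZK; Pollack–Rubin 2004; the period-unit facts) plus the pair's own `BSD(E,p)`, which the tree
settles per pair by the b2b lane's flag-free exact-descent theorems `bsdp3_nn<label>` / `bsdp_s<label>`
(GZK + `r_an ≤ 1` + `p ∤ #Ш_an` + ONE certificate line `#Sel^(p)(E/ℚ) = p^(r_an)`), whose binders are
passed through and DISPLAYED (`hr`, `hs`, `hvs`, `hSel`). Mechanism (class theorems
`kobayashiMainConjecture_of_cmPartner_of_bsdp_of_analyticRank_eq_zero` /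
`…_of_lvalue_of_bsdp_…`, file `…SmallImageMuTransferCM.lean`): Pollack–Rubin + the partner's
`μ(L_p^±(E')) = 0` ⟹ `μ(X^±(E')) = 0` ⟹ (Kim 2009, along the certified `E[p] ≃ E'[p]`) `μ(X^±(E)) = 0` ⟹
Kobayashi's RATIONAL Kato divisibility is INTEGRAL (Gauss' lemma in `Λ`) ⟹ with `r_an = 0` and
`BSD(E,p)` the constant-term squeeze (Kim 2013 + GZK + Kobayashi (3.6) + period units) gives the
EQUALITY. The partner data (`card_*`, `hasCM_*`) and the Hesse / `c₄`, `c₆` identities are those of the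
landed record (imported / re-checked by `norm_num`, `decide`). Non-kernel inputs per pair, all
displayed: the partner certificate (`hL'` unit case / `hμ'` two-engine `μ`-certificate — values and
engines quoted in the landed record's docstring), Cremona's `r_an = 0` and `#Ш_an`, the descent line.

PARTITION (cell bsd-ssimc): X7 (A7) × 5 of item 4's 76 rank-0 CM-EC-partnered pairs —
types-the-object-of (per-pair kernel records at the «published + certificates» tier); closes NONE.

References: [BDKim2009] Cor. 2.13; [Kobayashi2003] Thm. 1.2, Thm. 4.1, (3.6), Conjecture (p. 2);
[PollackRubin2004] Thm. (p. 448); [BDKim2013] Cor. 3.15; [Fisher2012Hessian] §13; [Cremona2006];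
[Miller2011LMS] Def. 1.1; [SchaeferStoll2004] (the descent certificates, via the cited tree theorems).
-/

set_option autoImplicit false
set_option linter.dupNamespace false

noncomputable section

open scoped Classical MatrixGroups ModularForm

open CongruenceSubgroup WeierstrassCurve Literature.NumberTheory.EllipticCurves
  Literature.NumberTheory.EllipticCurves.ModularForms
  Literature.NumberTheory.EllipticCurves.Kobayashi2003 ZpExtension
  Literature.NumberTheory.EllipticCurves.GreenbergVatsal2000
  Literature.NumberTheory.EllipticCurves.BDKim2009
  Literature.NumberTheory.EllipticCurves.Rank1Residual
  Literature.NumberTheory.EllipticCurves.Rank1Residual.Typed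
  Literature.NumberTheory.EllipticCurves.Rank1Residual.X11RankOneCertificates
  Literature.NumberTheory.EllipticCurves.Fisher2012
  Summit.BirchSwinnertonDyer.BirchSwinnertonDyer.Rank1Residual.IntModel
  Summit.BirchSwinnertonDyer.BirchSwinnertonDyer.Rank1Residual.X11RankOne
  Summit.BirchSwinnertonDyer.Rank1Residual.X11b
  Summit.BirchSwinnertonDyer.Rank1Residual.X9
  Summit.BirchSwinnertonDyer.Rank1Residual.X1
  Summit.BirchSwinnertonDyer.Rank1Residual.Supersingular

namespace Summit.BirchSwinnertonDyer.BirchSwinnertonDyer.Theorems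

/-- **Kobayashi's ± main conjecture, BOTH signs, for `133600d1 @ 3` (Cremona model `[0, 0, 0, -4592675, 3788320250]`, analytic rank `0`; item-4 pair:
X7, `a_3 = 0`, image `3Nn`) from PUBLISHED named facts + displayed certificates — NO preprint binder.** Same CM partner `A`,
same kernel-certified congruence `E[3] ≃ E'[3]` (Hesse pencil identity, `norm_num`) and same partner certificate as the landed
L4-CM record `kobayashiMainConjecture_c133600d1_3_of_mu_of_transfer_OPEN` (file `SignedLowerHalvesKobayashiMainConjectureSmallImageCMTransferMuRecords01.lean`), whose OPEN binder `hCL` (Corpuz–Lei 2025, PRE) is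
REPLACED by: B. D. Kim 2009 Cor. 2.13 (`h09`), Kobayashi 2003 Thm. 1.2 / 4.1-rational (`h12`, `h41`), B. D. Kim 2013 Cor. 3.15 (`hKim`),
Pollack (`hPollack`), modularity (`hmod`, `hmod'`), GZK (`hGZK`) — all PUBLISHED, by name — plus the pair's own `BSD(E,3)`, taken from the
tree's flag-free exact-descent theorem `bsdp3_nn133600d1` (`NonsplitCartanThreeDescentRecordsX7Three02.lean`) through its binders, displayed here:
`hr` (`r_an = 0`, Cremona), `hs`/`hvs` (`#Ш_an = s` with `ord_3 s = 0`, Cremona), `hSel` (the certificate line `#Sel^(3)(E/ℚ) = 3^0`,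
two-engine exact `3`-descent of the b2b lane, quoted in that theorem's docstring). Partner side: μ-binder `hμ'` (unit content of Kobayashi's `L_p^±` of the partner — the two-engine certificate of the landed L4-CM record, quoted there);
BY NAME `hPR`, `h5`, `h3`. Chain: `kobayashiMainConjecture_of_cmPartner_of_bsdp_of_analyticRank_eq_zero` (μ-transfer ⟹ integral Kato
divisibility ⟹ constant-term squeeze). Per pair; item 4 stays OPEN; nothing booked; BSD is not proved by any of this.
[cite: BDKim2009, Cor. 2.13 (p. 187)] [cite: PollackRubin2004, Theorem (p. 448) = Thm. 7.3] [cite: Kobayashi2003, Thm. 4.1 (p. 8) and Conjecture (p. 2)]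
[cite: Fisher2012Hessian, §13 (analogue of Thm. 13.2 for X_E^-(3))] [cite: Cremona2006, Table 1 (Cremona label 133600d1)] -/
theorem kobayashiMainConjecture_c133600d1_3_of_mu_of_bsdp
    (h09 : cor213_signedMu_eq_zero_iff_of_torsionIso)
    (hPR : PollackRubin2004.mainTheorem_signedCharIdeal_eq_of_cm)
    (h12 : Kobayashi2003.thm12_signedSelmerDual_finite_torsion)
    (h41 : Kobayashi2003.thm41_signedCharIdeal_divisibility)
    (hKim : BDKim2013.cor315_signedCharValue_rankZero)
    (h5 : realPeriodRat_eq_unit_mul_plusPeriod) (h3 : realPeriodRat_eq_unit_mul_plusPeriod_three)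
    (hPollack : ∀ {V : WeierstrassCurve ℚ} [V.IsElliptic] [V.IsGloballyMinimal] {N : ℕ} [NeZero N]
      {g : CuspForm (Gamma0 N) 2} {q : ℕ} [Fact q.Prime],
      pollack_exists_plusMinusPAdicLFunction (W := V) (f := g) (p := q))
    (hmod : nonempty_modularParametrizationData) (hmod' : hasEntireLFunction_rat)
    (hGZK : rank_eq_analyticRank_of_analyticRank_le_one)
    (W A : WeierstrassCurve ℚ) [W.IsElliptic] [W.IsGloballyMinimal] [A.IsElliptic] [A.IsGloballyMinimal]
    [Fact (Nat.Prime 3)] (hW : W = ⟨0, 0, 0, -4592675, 3788320250⟩) (hA : A = ⟨0, 0, 0, -25, 0⟩)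
    (hμ' : ∀ [NeZero (A.conductorNorm ℤ)] (f' : CuspForm (Gamma0 (A.conductorNorm ℤ)) 2),
      IsNewformOf A f' → ∀ (Lplus Lminus : IwasawaAlgebra 3), IsPollackPair f' 3 Lplus Lminus →
      ∀ ε : ℤˣ, HasUnitContent (kobayashiL ε Lplus Lminus))
    (hr : W.analyticRank = 0) {s : ℚ} (hs : shaAn W = (s : ℂ)) (hvs : padicValRat 3 s = 0)
    (hSel : Nat.card (W.selmerGroup (3 : ℤ)) = 3 ^ W.analyticRank) (ε : ℤˣ) :
    KobayashiMainConjecture W 3 ε := by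
  have hIW : integralModelInt W = ⟨0, 0, 0, -4592675, 3788320250⟩ :=
    integralModelInt_eq_of_map_eq _ (by rw [hW]; ext <;> simp [WeierstrassCurve.map])
  have hIA : integralModelInt A = ⟨0, 0, 0, -25, 0⟩ :=
    integralModelInt_eq_of_map_eq _ (by rw [hA]; ext <;> simp [WeierstrassCurve.map])
  have hΔ : (⟨0, 0, 0, -4592675, 3788320250⟩ : WeierstrassCurve ℤ).Δ = discOf [0, 0, 0, -4592675, 3788320250] :=
    intCurve_Δ 0 0 0 (-4592675) 3788320250
  have hΔA : (⟨0, 0, 0, -25, 0⟩ : WeierstrassCurve ℤ).Δ = discOf [0, 0, 0, -25, 0] :=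
    intCurve_Δ 0 0 0 (-25) 0
  have hgood : W.HasGoodReductionAtPrime 3 :=
    hasGoodReductionAtPrime_of_not_dvd W 3 (by rw [minimalDiscriminantInt_eq hIW, hΔ]; decide +kernel)
  have hgoodA : A.HasGoodReductionAtPrime 3 :=
    hasGoodReductionAtPrime_of_not_dvd A 3 (by rw [minimalDiscriminantInt_eq hIA, hΔA]; decide +kernel)
  have hap : W.frobeniusTrace 3 = 0 := by rw [frobeniusTrace_eq hIW card_c133600d1_3]; norm_num
  have hapA : A.frobeniusTrace 3 = 0 := by rw [frobeniusTrace_eq hIA card_cmm25_0_3]; norm_num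
  have hc4 : W.c₄ = (220448400 : ℚ) := by
    subst hW; norm_num [WeierstrassCurve.c₄, WeierstrassCurve.b₂, WeierstrassCurve.b₄]
  have hc6 : W.c₆ = (-3273108696000 : ℚ) := by
    subst hW; norm_num [WeierstrassCurve.c₆, WeierstrassCurve.b₂, WeierstrassCurve.b₄, WeierstrassCurve.b₆]
  have hc4A : A.c₄ = (1200 : ℚ) := by
    subst hA; norm_num [WeierstrassCurve.c₄, WeierstrassCurve.b₂, WeierstrassCurve.b₄]
  have hc6A : A.c₆ = (0 : ℚ) := by
    subst hA; norm_num [WeierstrassCurve.c₆, WeierstrassCurve.b₂, WeierstrassCurve.b₄, WeierstrassCurve.b₆]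
  have hiso := threeCongruent_of_dualHesseCertificate_unconditional A W ((260 : ℚ) / 11) 1 ((1 : ℚ) / 660)
    (by norm_num) (by rw [hc4A, hc6A, hc4, eval_hesseD3]; norm_num)
    (by rw [hc4A, hc6A, hc6, eval_hesseC6three]; norm_num)
  exact kobayashiMainConjecture_of_cmPartner_of_bsdp_of_analyticRank_eq_zero W A 3 h09 hPR h12 h41 hKim h5
    h3 hPollack hmod hmod' hGZK (by norm_num) hgood hap
    (hasCM_cmm25_0 hIA) ⟨hgoodA, by rw [hapA]; exact dvd_zero _⟩ hapA hiso hμ' hr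
    (bsdp3_nn133600d1 hGZK W hW (hr.trans_le zero_le_one) hs hvs hSel) ε

/-- **Kobayashi's ± main conjecture, BOTH signs, for `200800i1 @ 3` (Cremona model `[0, 0, 0, -1343800, 599586000]`, analytic rank `0`; item-4 pair:
X7, `a_3 = 0`, image `3Nn`) from PUBLISHED named facts + displayed certificates — NO preprint binder.** Same CM partner `A`,
same kernel-certified congruence `E[3] ≃ E'[3]` (Hesse pencil identity, `norm_num`) and same partner certificate as the landed
L4-CM record `kobayashiMainConjecture_c200800i1_3_of_mu_of_transfer_OPEN` (file `SignedLowerHalvesKobayashiMainConjectureSmallImageCMTransferMuRecords01.lean`), whose OPEN binder `hCL` (Corpuz–Lei 2025, PRE) is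
REPLACED by: B. D. Kim 2009 Cor. 2.13 (`h09`), Kobayashi 2003 Thm. 1.2 / 4.1-rational (`h12`, `h41`), B. D. Kim 2013 Cor. 3.15 (`hKim`),
Pollack (`hPollack`), modularity (`hmod`, `hmod'`), GZK (`hGZK`) — all PUBLISHED, by name — plus the pair's own `BSD(E,3)`, taken from the
tree's flag-free exact-descent theorem `bsdp3_nn200800i1` (`NonsplitCartanThreeDescentRecordsX7Three03.lean`) through its binders, displayed here:
`hr` (`r_an = 0`, Cremona), `hs`/`hvs` (`#Ш_an = s` with `ord_3 s = 0`, Cremona), `hSel` (the certificate line `#Sel^(3)(E/ℚ) = 3^0`,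
two-engine exact `3`-descent of the b2b lane, quoted in that theorem's docstring). Partner side: μ-binder `hμ'` (unit content of Kobayashi's `L_p^±` of the partner — the two-engine certificate of the landed L4-CM record, quoted there);
BY NAME `hPR`, `h5`, `h3`. Chain: `kobayashiMainConjecture_of_cmPartner_of_bsdp_of_analyticRank_eq_zero` (μ-transfer ⟹ integral Kato
divisibility ⟹ constant-term squeeze). Per pair; item 4 stays OPEN; nothing booked; BSD is not proved by any of this.
[cite: BDKim2009, Cor. 2.13 (p. 187)] [cite: PollackRubin2004, Theorem (p. 448) = Thm. 7.3] [cite: Kobayashi2003, Thm. 4.1 (p. 8) and Conjecture (p. 2)]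
[cite: Fisher2012Hessian, §13 (analogue of Thm. 13.2 for X_E^-(3))] [cite: Cremona2006, Table 1 (Cremona label 200800i1)] -/
theorem kobayashiMainConjecture_c200800i1_3_of_mu_of_bsdp
    (h09 : cor213_signedMu_eq_zero_iff_of_torsionIso)
    (hPR : PollackRubin2004.mainTheorem_signedCharIdeal_eq_of_cm)
    (h12 : Kobayashi2003.thm12_signedSelmerDual_finite_torsion)
    (h41 : Kobayashi2003.thm41_signedCharIdeal_divisibility)
    (hKim : BDKim2013.cor315_signedCharValue_rankZero)
    (h5 : realPeriodRat_eq_unit_mul_plusPeriod) (h3 : realPeriodRat_eq_unit_mul_plusPeriod_three)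
    (hPollack : ∀ {V : WeierstrassCurve ℚ} [V.IsElliptic] [V.IsGloballyMinimal] {N : ℕ} [NeZero N]
      {g : CuspForm (Gamma0 N) 2} {q : ℕ} [Fact q.Prime],
      pollack_exists_plusMinusPAdicLFunction (W := V) (f := g) (p := q))
    (hmod : nonempty_modularParametrizationData) (hmod' : hasEntireLFunction_rat)
    (hGZK : rank_eq_analyticRank_of_analyticRank_le_one)
    (W A : WeierstrassCurve ℚ) [W.IsElliptic] [W.IsGloballyMinimal] [A.IsElliptic] [A.IsGloballyMinimal]
    [Fact (Nat.Prime 3)] (hW : W = ⟨0, 0, 0, -1343800, 599586000⟩) (hA : A = ⟨0, 0, 0, -25, 0⟩)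
    (hμ' : ∀ [NeZero (A.conductorNorm ℤ)] (f' : CuspForm (Gamma0 (A.conductorNorm ℤ)) 2),
      IsNewformOf A f' → ∀ (Lplus Lminus : IwasawaAlgebra 3), IsPollackPair f' 3 Lplus Lminus →
      ∀ ε : ℤˣ, HasUnitContent (kobayashiL ε Lplus Lminus))
    (hr : W.analyticRank = 0) {s : ℚ} (hs : shaAn W = (s : ℂ)) (hvs : padicValRat 3 s = 0)
    (hSel : Nat.card (W.selmerGroup (3 : ℤ)) = 3 ^ W.analyticRank) (ε : ℤˣ) :
    KobayashiMainConjecture W 3 ε := by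
  have hIW : integralModelInt W = ⟨0, 0, 0, -1343800, 599586000⟩ :=
    integralModelInt_eq_of_map_eq _ (by rw [hW]; ext <;> simp [WeierstrassCurve.map])
  have hIA : integralModelInt A = ⟨0, 0, 0, -25, 0⟩ :=
    integralModelInt_eq_of_map_eq _ (by rw [hA]; ext <;> simp [WeierstrassCurve.map])
  have hΔ : (⟨0, 0, 0, -1343800, 599586000⟩ : WeierstrassCurve ℤ).Δ = discOf [0, 0, 0, -1343800, 599586000] :=
    intCurve_Δ 0 0 0 (-1343800) 599586000
  have hΔA : (⟨0, 0, 0, -25, 0⟩ : WeierstrassCurve ℤ).Δ = discOf [0, 0, 0, -25, 0] :=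
    intCurve_Δ 0 0 0 (-25) 0
  have hgood : W.HasGoodReductionAtPrime 3 :=
    hasGoodReductionAtPrime_of_not_dvd W 3 (by rw [minimalDiscriminantInt_eq hIW, hΔ]; decide +kernel)
  have hgoodA : A.HasGoodReductionAtPrime 3 :=
    hasGoodReductionAtPrime_of_not_dvd A 3 (by rw [minimalDiscriminantInt_eq hIA, hΔA]; decide +kernel)
  have hap : W.frobeniusTrace 3 = 0 := by rw [frobeniusTrace_eq hIW card_c200800i1_3]; norm_num
  have hapA : A.frobeniusTrace 3 = 0 := by rw [frobeniusTrace_eq hIA card_cmm25_0_3]; norm_num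
  have hc4 : W.c₄ = (64502400 : ℚ) := by
    subst hW; norm_num [WeierstrassCurve.c₄, WeierstrassCurve.b₂, WeierstrassCurve.b₄]
  have hc6 : W.c₆ = (-518042304000 : ℚ) := by
    subst hW; norm_num [WeierstrassCurve.c₆, WeierstrassCurve.b₂, WeierstrassCurve.b₄, WeierstrassCurve.b₆]
  have hc4A : A.c₄ = (1200 : ℚ) := by
    subst hA; norm_num [WeierstrassCurve.c₄, WeierstrassCurve.b₂, WeierstrassCurve.b₄]
  have hc6A : A.c₆ = (0 : ℚ) := by
    subst hA; norm_num [WeierstrassCurve.c₆, WeierstrassCurve.b₂, WeierstrassCurve.b₄, WeierstrassCurve.b₆]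
  have hiso := threeCongruent_of_hesseCertificate_unconditional A W ((-260 : ℚ) / 3) 1 ((20 : ℚ) / 3)
    (by norm_num) (by rw [hc4A, hc6A, hc4, eval_hesseC4three]; norm_num)
    (by rw [hc4A, hc6A, hc6, eval_hesseC6three]; norm_num)
  exact kobayashiMainConjecture_of_cmPartner_of_bsdp_of_analyticRank_eq_zero W A 3 h09 hPR h12 h41 hKim h5
    h3 hPollack hmod hmod' hGZK (by norm_num) hgood hap
    (hasCM_cmm25_0 hIA) ⟨hgoodA, by rw [hapA]; exact dvd_zero _⟩ hapA hiso hμ' hr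
    (bsdp3_nn200800i1 hGZK W hW (hr.trans_le zero_le_one) hs hvs hSel) ε

/-- **Kobayashi's ± main conjecture, BOTH signs, for `248800f1 @ 3` (Cremona model `[0, 0, 0, -35075, 2636250]`, analytic rank `0`; item-4 pair:
X7, `a_3 = 0`, image `3Nn`) from PUBLISHED named facts + displayed certificates — NO preprint binder.** Same CM partner `A`,
same kernel-certified congruence `E[3] ≃ E'[3]` (Hesse pencil identity, `norm_num`) and same partner certificate as the landed
L4-CM record `kobayashiMainConjecture_c248800f1_3_of_mu_of_transfer_OPEN` (file `SignedLowerHalvesKobayashiMainConjectureSmallImageCMTransferMuRecords01.lean`), whose OPEN binder `hCL` (Corpuz–Lei 2025, PRE) is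
REPLACED by: B. D. Kim 2009 Cor. 2.13 (`h09`), Kobayashi 2003 Thm. 1.2 / 4.1-rational (`h12`, `h41`), B. D. Kim 2013 Cor. 3.15 (`hKim`),
Pollack (`hPollack`), modularity (`hmod`, `hmod'`), GZK (`hGZK`) — all PUBLISHED, by name — plus the pair's own `BSD(E,3)`, taken from the
tree's flag-free exact-descent theorem `bsdp3_nn248800f1` (`NonsplitCartanThreeDescentRecordsX7Three04.lean`) through its binders, displayed here:
`hr` (`r_an = 0`, Cremona), `hs`/`hvs` (`#Ш_an = s` with `ord_3 s = 0`, Cremona), `hSel` (the certificate line `#Sel^(3)(E/ℚ) = 3^0`,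
two-engine exact `3`-descent of the b2b lane, quoted in that theorem's docstring). Partner side: μ-binder `hμ'` (unit content of Kobayashi's `L_p^±` of the partner — the two-engine certificate of the landed L4-CM record, quoted there);
BY NAME `hPR`, `h5`, `h3`. Chain: `kobayashiMainConjecture_of_cmPartner_of_bsdp_of_analyticRank_eq_zero` (μ-transfer ⟹ integral Kato
divisibility ⟹ constant-term squeeze). Per pair; item 4 stays OPEN; nothing booked; BSD is not proved by any of this.
[cite: BDKim2009, Cor. 2.13 (p. 187)] [cite: PollackRubin2004, Theorem (p. 448) = Thm. 7.3] [cite: Kobayashi2003, Thm. 4.1 (p. 8) and Conjecture (p. 2)]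
[cite: Fisher2012Hessian, §13 (analogue of Thm. 13.2 for X_E^-(3))] [cite: Cremona2006, Table 1 (Cremona label 248800f1)] -/
theorem kobayashiMainConjecture_c248800f1_3_of_mu_of_bsdp
    (h09 : cor213_signedMu_eq_zero_iff_of_torsionIso)
    (hPR : PollackRubin2004.mainTheorem_signedCharIdeal_eq_of_cm)
    (h12 : Kobayashi2003.thm12_signedSelmerDual_finite_torsion)
    (h41 : Kobayashi2003.thm41_signedCharIdeal_divisibility)
    (hKim : BDKim2013.cor315_signedCharValue_rankZero)
    (h5 : realPeriodRat_eq_unit_mul_plusPeriod) (h3 : realPeriodRat_eq_unit_mul_plusPeriod_three)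
    (hPollack : ∀ {V : WeierstrassCurve ℚ} [V.IsElliptic] [V.IsGloballyMinimal] {N : ℕ} [NeZero N]
      {g : CuspForm (Gamma0 N) 2} {q : ℕ} [Fact q.Prime],
      pollack_exists_plusMinusPAdicLFunction (W := V) (f := g) (p := q))
    (hmod : nonempty_modularParametrizationData) (hmod' : hasEntireLFunction_rat)
    (hGZK : rank_eq_analyticRank_of_analyticRank_le_one)
    (W A : WeierstrassCurve ℚ) [W.IsElliptic] [W.IsGloballyMinimal] [A.IsElliptic] [A.IsGloballyMinimal]
    [Fact (Nat.Prime 3)] (hW : W = ⟨0, 0, 0, -35075, 2636250⟩) (hA : A = ⟨0, 0, 0, -25, 0⟩)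
    (hμ' : ∀ [NeZero (A.conductorNorm ℤ)] (f' : CuspForm (Gamma0 (A.conductorNorm ℤ)) 2),
      IsNewformOf A f' → ∀ (Lplus Lminus : IwasawaAlgebra 3), IsPollackPair f' 3 Lplus Lminus →
      ∀ ε : ℤˣ, HasUnitContent (kobayashiL ε Lplus Lminus))
    (hr : W.analyticRank = 0) {s : ℚ} (hs : shaAn W = (s : ℂ)) (hvs : padicValRat 3 s = 0)
    (hSel : Nat.card (W.selmerGroup (3 : ℤ)) = 3 ^ W.analyticRank) (ε : ℤˣ) :
    KobayashiMainConjecture W 3 ε := by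
  have hIW : integralModelInt W = ⟨0, 0, 0, -35075, 2636250⟩ :=
    integralModelInt_eq_of_map_eq _ (by rw [hW]; ext <;> simp [WeierstrassCurve.map])
  have hIA : integralModelInt A = ⟨0, 0, 0, -25, 0⟩ :=
    integralModelInt_eq_of_map_eq _ (by rw [hA]; ext <;> simp [WeierstrassCurve.map])
  have hΔ : (⟨0, 0, 0, -35075, 2636250⟩ : WeierstrassCurve ℤ).Δ = discOf [0, 0, 0, -35075, 2636250] :=
    intCurve_Δ 0 0 0 (-35075) 2636250
  have hΔA : (⟨0, 0, 0, -25, 0⟩ : WeierstrassCurve ℤ).Δ = discOf [0, 0, 0, -25, 0] :=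
    intCurve_Δ 0 0 0 (-25) 0
  have hgood : W.HasGoodReductionAtPrime 3 :=
    hasGoodReductionAtPrime_of_not_dvd W 3 (by rw [minimalDiscriminantInt_eq hIW, hΔ]; decide +kernel)
  have hgoodA : A.HasGoodReductionAtPrime 3 :=
    hasGoodReductionAtPrime_of_not_dvd A 3 (by rw [minimalDiscriminantInt_eq hIA, hΔA]; decide +kernel)
  have hap : W.frobeniusTrace 3 = 0 := by rw [frobeniusTrace_eq hIW card_c248800f1_3]; norm_num
  have hapA : A.frobeniusTrace 3 = 0 := by rw [frobeniusTrace_eq hIA card_cmm25_0_3]; norm_num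
  have hc4 : W.c₄ = (1683600 : ℚ) := by
    subst hW; norm_num [WeierstrassCurve.c₄, WeierstrassCurve.b₂, WeierstrassCurve.b₄]
  have hc6 : W.c₆ = (-2277720000 : ℚ) := by
    subst hW; norm_num [WeierstrassCurve.c₆, WeierstrassCurve.b₂, WeierstrassCurve.b₄, WeierstrassCurve.b₆]
  have hc4A : A.c₄ = (1200 : ℚ) := by
    subst hA; norm_num [WeierstrassCurve.c₄, WeierstrassCurve.b₂, WeierstrassCurve.b₄]
  have hc6A : A.c₆ = (0 : ℚ) := by
    subst hA; norm_num [WeierstrassCurve.c₆, WeierstrassCurve.b₂, WeierstrassCurve.b₄, WeierstrassCurve.b₆]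
  have hiso := threeCongruent_of_dualHesseCertificate_unconditional A W ((100 : ℚ) / 3) 1 ((1 : ℚ) / 180)
    (by norm_num) (by rw [hc4A, hc6A, hc4, eval_hesseD3]; norm_num)
    (by rw [hc4A, hc6A, hc6, eval_hesseC6three]; norm_num)
  exact kobayashiMainConjecture_of_cmPartner_of_bsdp_of_analyticRank_eq_zero W A 3 h09 hPR h12 h41 hKim h5
    h3 hPollack hmod hmod' hGZK (by norm_num) hgood hap
    (hasCM_cmm25_0 hIA) ⟨hgoodA, by rw [hapA]; exact dvd_zero _⟩ hapA hiso hμ' hr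
    (bsdp3_nn248800f1 hGZK W hW (hr.trans_le zero_le_one) hs hvs hSel) ε

/-- **Kobayashi's ± main conjecture, BOTH signs, for `325600y1 @ 3` (Cremona model `[0, 0, 0, -1699525, -852663000]`, analytic rank `0`; item-4 pair:
X7, `a_3 = 0`, image `3Nn`) from PUBLISHED named facts + displayed certificates — NO preprint binder.** Same CM partner `A`,
same kernel-certified congruence `E[3] ≃ E'[3]` (Hesse pencil identity, `norm_num`) and same partner certificate as the landed
L4-CM record `kobayashiMainConjecture_c325600y1_3_of_mu_of_transfer_OPEN` (file `SignedLowerHalvesKobayashiMainConjectureSmallImageCMTransferMuRecords01.lean`), whose OPEN binder `hCL` (Corpuz–Lei 2025, PRE) is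
REPLACED by: B. D. Kim 2009 Cor. 2.13 (`h09`), Kobayashi 2003 Thm. 1.2 / 4.1-rational (`h12`, `h41`), B. D. Kim 2013 Cor. 3.15 (`hKim`),
Pollack (`hPollack`), modularity (`hmod`, `hmod'`), GZK (`hGZK`) — all PUBLISHED, by name — plus the pair's own `BSD(E,3)`, taken from the
tree's flag-free exact-descent theorem `bsdp3_nn325600y1` (`NonsplitCartanThreeDescentRecordsX7Three05.lean`) through its binders, displayed here:
`hr` (`r_an = 0`, Cremona), `hs`/`hvs` (`#Ш_an = s` with `ord_3 s = 0`, Cremona), `hSel` (the certificate line `#Sel^(3)(E/ℚ) = 3^0`,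
two-engine exact `3`-descent of the b2b lane, quoted in that theorem's docstring). Partner side: μ-binder `hμ'` (unit content of Kobayashi's `L_p^±` of the partner — the two-engine certificate of the landed L4-CM record, quoted there);
BY NAME `hPR`, `h5`, `h3`. Chain: `kobayashiMainConjecture_of_cmPartner_of_bsdp_of_analyticRank_eq_zero` (μ-transfer ⟹ integral Kato
divisibility ⟹ constant-term squeeze). Per pair; item 4 stays OPEN; nothing booked; BSD is not proved by any of this.
[cite: BDKim2009, Cor. 2.13 (p. 187)] [cite: PollackRubin2004, Theorem (p. 448) = Thm. 7.3] [cite: Kobayashi2003, Thm. 4.1 (p. 8) and Conjecture (p. 2)]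
[cite: Fisher2012Hessian, §13 (analogue of Thm. 13.2 for X_E^-(3))] [cite: Cremona2006, Table 1 (Cremona label 325600y1)] -/
theorem kobayashiMainConjecture_c325600y1_3_of_mu_of_bsdp
    (h09 : cor213_signedMu_eq_zero_iff_of_torsionIso)
    (hPR : PollackRubin2004.mainTheorem_signedCharIdeal_eq_of_cm)
    (h12 : Kobayashi2003.thm12_signedSelmerDual_finite_torsion)
    (h41 : Kobayashi2003.thm41_signedCharIdeal_divisibility)
    (hKim : BDKim2013.cor315_signedCharValue_rankZero)
    (h5 : realPeriodRat_eq_unit_mul_plusPeriod) (h3 : realPeriodRat_eq_unit_mul_plusPeriod_three)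
    (hPollack : ∀ {V : WeierstrassCurve ℚ} [V.IsElliptic] [V.IsGloballyMinimal] {N : ℕ} [NeZero N]
      {g : CuspForm (Gamma0 N) 2} {q : ℕ} [Fact q.Prime],
      pollack_exists_plusMinusPAdicLFunction (W := V) (f := g) (p := q))
    (hmod : nonempty_modularParametrizationData) (hmod' : hasEntireLFunction_rat)
    (hGZK : rank_eq_analyticRank_of_analyticRank_le_one)
    (W A : WeierstrassCurve ℚ) [W.IsElliptic] [W.IsGloballyMinimal] [A.IsElliptic] [A.IsGloballyMinimal]
    [Fact (Nat.Prime 3)] (hW : W = ⟨0, 0, 0, -1699525, -852663000⟩) (hA : A = ⟨0, 0, 0, -25, 0⟩)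
    (hμ' : ∀ [NeZero (A.conductorNorm ℤ)] (f' : CuspForm (Gamma0 (A.conductorNorm ℤ)) 2),
      IsNewformOf A f' → ∀ (Lplus Lminus : IwasawaAlgebra 3), IsPollackPair f' 3 Lplus Lminus →
      ∀ ε : ℤˣ, HasUnitContent (kobayashiL ε Lplus Lminus))
    (hr : W.analyticRank = 0) {s : ℚ} (hs : shaAn W = (s : ℂ)) (hvs : padicValRat 3 s = 0)
    (hSel : Nat.card (W.selmerGroup (3 : ℤ)) = 3 ^ W.analyticRank) (ε : ℤˣ) :
    KobayashiMainConjecture W 3 ε := by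
  have hIW : integralModelInt W = ⟨0, 0, 0, -1699525, -852663000⟩ :=
    integralModelInt_eq_of_map_eq _ (by rw [hW]; ext <;> simp [WeierstrassCurve.map])
  have hIA : integralModelInt A = ⟨0, 0, 0, -25, 0⟩ :=
    integralModelInt_eq_of_map_eq _ (by rw [hA]; ext <;> simp [WeierstrassCurve.map])
  have hΔ : (⟨0, 0, 0, -1699525, -852663000⟩ : WeierstrassCurve ℤ).Δ = discOf [0, 0, 0, -1699525, -852663000] :=
    intCurve_Δ 0 0 0 (-1699525) (-852663000)
  have hΔA : (⟨0, 0, 0, -25, 0⟩ : WeierstrassCurve ℤ).Δ = discOf [0, 0, 0, -25, 0] :=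
    intCurve_Δ 0 0 0 (-25) 0
  have hgood : W.HasGoodReductionAtPrime 3 :=
    hasGoodReductionAtPrime_of_not_dvd W 3 (by rw [minimalDiscriminantInt_eq hIW, hΔ]; decide +kernel)
  have hgoodA : A.HasGoodReductionAtPrime 3 :=
    hasGoodReductionAtPrime_of_not_dvd A 3 (by rw [minimalDiscriminantInt_eq hIA, hΔA]; decide +kernel)
  have hap : W.frobeniusTrace 3 = 0 := by rw [frobeniusTrace_eq hIW card_c325600y1_3]; norm_num
  have hapA : A.frobeniusTrace 3 = 0 := by rw [frobeniusTrace_eq hIA card_cmm25_0_3]; norm_num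
  have hc4 : W.c₄ = (81577200 : ℚ) := by
    subst hW; norm_num [WeierstrassCurve.c₄, WeierstrassCurve.b₂, WeierstrassCurve.b₄]
  have hc6 : W.c₆ = (736700832000 : ℚ) := by
    subst hW; norm_num [WeierstrassCurve.c₆, WeierstrassCurve.b₂, WeierstrassCurve.b₄, WeierstrassCurve.b₆]
  have hc4A : A.c₄ = (1200 : ℚ) := by
    subst hA; norm_num [WeierstrassCurve.c₄, WeierstrassCurve.b₂, WeierstrassCurve.b₄]
  have hc6A : A.c₆ = (0 : ℚ) := by
    subst hA; norm_num [WeierstrassCurve.c₆, WeierstrassCurve.b₂, WeierstrassCurve.b₄, WeierstrassCurve.b₆]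
  have hiso := threeCongruent_of_hesseCertificate_unconditional A W ((280 : ℚ) / 3) 1 ((20 : ℚ) / 3)
    (by norm_num) (by rw [hc4A, hc6A, hc4, eval_hesseC4three]; norm_num)
    (by rw [hc4A, hc6A, hc6, eval_hesseC6three]; norm_num)
  exact kobayashiMainConjecture_of_cmPartner_of_bsdp_of_analyticRank_eq_zero W A 3 h09 hPR h12 h41 hKim h5
    h3 hPollack hmod hmod' hGZK (by norm_num) hgood hap
    (hasCM_cmm25_0 hIA) ⟨hgoodA, by rw [hapA]; exact dvd_zero _⟩ hapA hiso hμ' hr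
    (bsdp3_nn325600y1 hGZK W hW (hr.trans_le zero_le_one) hs hvs hSel) ε

/-- **Kobayashi's ± main conjecture, BOTH signs, for `325600z1 @ 3` (Cremona model `[0, 0, 0, 9325, -1062250]`, analytic rank `0`; item-4 pair:
X7, `a_3 = 0`, image `3Nn`) from PUBLISHED named facts + displayed certificates — NO preprint binder.** Same CM partner `A`,
same kernel-certified congruence `E[3] ≃ E'[3]` (Hesse pencil identity, `norm_num`) and same partner certificate as the landed
L4-CM record `kobayashiMainConjecture_c325600z1_3_of_mu_of_transfer_OPEN` (file `SignedLowerHalvesKobayashiMainConjectureSmallImageCMTransferMuRecords01.lean`), whose OPEN binder `hCL` (Corpuz–Lei 2025, PRE) is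
REPLACED by: B. D. Kim 2009 Cor. 2.13 (`h09`), Kobayashi 2003 Thm. 1.2 / 4.1-rational (`h12`, `h41`), B. D. Kim 2013 Cor. 3.15 (`hKim`),
Pollack (`hPollack`), modularity (`hmod`, `hmod'`), GZK (`hGZK`) — all PUBLISHED, by name — plus the pair's own `BSD(E,3)`, taken from the
tree's flag-free exact-descent theorem `bsdp3_nn325600z1` (`NonsplitCartanThreeDescentRecordsX7Three05.lean`) through its binders, displayed here:
`hr` (`r_an = 0`, Cremona), `hs`/`hvs` (`#Ш_an = s` with `ord_3 s = 0`, Cremona), `hSel` (the certificate line `#Sel^(3)(E/ℚ) = 3^0`,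
two-engine exact `3`-descent of the b2b lane, quoted in that theorem's docstring). Partner side: μ-binder `hμ'` (unit content of Kobayashi's `L_p^±` of the partner — the two-engine certificate of the landed L4-CM record, quoted there);
BY NAME `hPR`, `h5`, `h3`. Chain: `kobayashiMainConjecture_of_cmPartner_of_bsdp_of_analyticRank_eq_zero` (μ-transfer ⟹ integral Kato
divisibility ⟹ constant-term squeeze). Per pair; item 4 stays OPEN; nothing booked; BSD is not proved by any of this.
[cite: BDKim2009, Cor. 2.13 (p. 187)] [cite: PollackRubin2004, Theorem (p. 448) = Thm. 7.3] [cite: Kobayashi2003, Thm. 4.1 (p. 8) and Conjecture (p. 2)]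
[cite: Fisher2012Hessian, §13 (analogue of Thm. 13.2 for X_E^-(3))] [cite: Cremona2006, Table 1 (Cremona label 325600z1)] -/
theorem kobayashiMainConjecture_c325600z1_3_of_mu_of_bsdp
    (h09 : cor213_signedMu_eq_zero_iff_of_torsionIso)
    (hPR : PollackRubin2004.mainTheorem_signedCharIdeal_eq_of_cm)
    (h12 : Kobayashi2003.thm12_signedSelmerDual_finite_torsion)
    (h41 : Kobayashi2003.thm41_signedCharIdeal_divisibility)
    (hKim : BDKim2013.cor315_signedCharValue_rankZero)
    (h5 : realPeriodRat_eq_unit_mul_plusPeriod) (h3 : realPeriodRat_eq_unit_mul_plusPeriod_three)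
    (hPollack : ∀ {V : WeierstrassCurve ℚ} [V.IsElliptic] [V.IsGloballyMinimal] {N : ℕ} [NeZero N]
      {g : CuspForm (Gamma0 N) 2} {q : ℕ} [Fact q.Prime],
      pollack_exists_plusMinusPAdicLFunction (W := V) (f := g) (p := q))
    (hmod : nonempty_modularParametrizationData) (hmod' : hasEntireLFunction_rat)
    (hGZK : rank_eq_analyticRank_of_analyticRank_le_one)
    (W A : WeierstrassCurve ℚ) [W.IsElliptic] [W.IsGloballyMinimal] [A.IsElliptic] [A.IsGloballyMinimal]
    [Fact (Nat.Prime 3)] (hW : W = ⟨0, 0, 0, 9325, -1062250⟩) (hA : A = ⟨0, 0, 0, -25, 0⟩)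
    (hμ' : ∀ [NeZero (A.conductorNorm ℤ)] (f' : CuspForm (Gamma0 (A.conductorNorm ℤ)) 2),
      IsNewformOf A f' → ∀ (Lplus Lminus : IwasawaAlgebra 3), IsPollackPair f' 3 Lplus Lminus →
      ∀ ε : ℤˣ, HasUnitContent (kobayashiL ε Lplus Lminus))
    (hr : W.analyticRank = 0) {s : ℚ} (hs : shaAn W = (s : ℂ)) (hvs : padicValRat 3 s = 0)
    (hSel : Nat.card (W.selmerGroup (3 : ℤ)) = 3 ^ W.analyticRank) (ε : ℤˣ) :
    KobayashiMainConjecture W 3 ε := by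
  have hIW : integralModelInt W = ⟨0, 0, 0, 9325, -1062250⟩ :=
    integralModelInt_eq_of_map_eq _ (by rw [hW]; ext <;> simp [WeierstrassCurve.map])
  have hIA : integralModelInt A = ⟨0, 0, 0, -25, 0⟩ :=
    integralModelInt_eq_of_map_eq _ (by rw [hA]; ext <;> simp [WeierstrassCurve.map])
  have hΔ : (⟨0, 0, 0, 9325, -1062250⟩ : WeierstrassCurve ℤ).Δ = discOf [0, 0, 0, 9325, -1062250] :=
    intCurve_Δ 0 0 0 9325 (-1062250)
  have hΔA : (⟨0, 0, 0, -25, 0⟩ : WeierstrassCurve ℤ).Δ = discOf [0, 0, 0, -25, 0] :=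
    intCurve_Δ 0 0 0 (-25) 0
  have hgood : W.HasGoodReductionAtPrime 3 :=
    hasGoodReductionAtPrime_of_not_dvd W 3 (by rw [minimalDiscriminantInt_eq hIW, hΔ]; decide +kernel)
  have hgoodA : A.HasGoodReductionAtPrime 3 :=
    hasGoodReductionAtPrime_of_not_dvd A 3 (by rw [minimalDiscriminantInt_eq hIA, hΔA]; decide +kernel)
  have hap : W.frobeniusTrace 3 = 0 := by rw [frobeniusTrace_eq hIW card_c325600z1_3]; norm_num
  have hapA : A.frobeniusTrace 3 = 0 := by rw [frobeniusTrace_eq hIA card_cmm25_0_3]; norm_num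
  have hc4 : W.c₄ = (-447600 : ℚ) := by
    subst hW; norm_num [WeierstrassCurve.c₄, WeierstrassCurve.b₂, WeierstrassCurve.b₄]
  have hc6 : W.c₆ = (917784000 : ℚ) := by
    subst hW; norm_num [WeierstrassCurve.c₆, WeierstrassCurve.b₂, WeierstrassCurve.b₄, WeierstrassCurve.b₆]
  have hc4A : A.c₄ = (1200 : ℚ) := by
    subst hA; norm_num [WeierstrassCurve.c₄, WeierstrassCurve.b₂, WeierstrassCurve.b₄]
  have hc6A : A.c₆ = (0 : ℚ) := by
    subst hA; norm_num [WeierstrassCurve.c₆, WeierstrassCurve.b₂, WeierstrassCurve.b₄, WeierstrassCurve.b₆]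
  have hiso := threeCongruent_of_dualHesseCertificate_unconditional A W (-140 : ℚ) 1 ((1 : ℚ) / 60)
    (by norm_num) (by rw [hc4A, hc6A, hc4, eval_hesseD3]; norm_num)
    (by rw [hc4A, hc6A, hc6, eval_hesseC6three]; norm_num)
  exact kobayashiMainConjecture_of_cmPartner_of_bsdp_of_analyticRank_eq_zero W A 3 h09 hPR h12 h41 hKim h5
    h3 hPollack hmod hmod' hGZK (by norm_num) hgood hap
    (hasCM_cmm25_0 hIA) ⟨hgoodA, by rw [hapA]; exact dvd_zero _⟩ hapA hiso hμ' hr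
    (bsdp3_nn325600z1 hGZK W hW (hr.trans_le zero_le_one) hs hvs hSel) ε

end Summit.BirchSwinnertonDyer.BirchSwinnertonDyer.Theorems

end
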